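import Summits.PneNP.PneNP.Theorems.SymmetryBudgetWindowCanoniserAssembly
import Summits.PneNP.PneNP.Theorems.SymmetryBudgetNoHiddenOrderIffNotWindowBarrier

/-!
# `WindowBarrier` is false

Route `PneNP/SymmetryBudget`, item `WindowBarrier` (stmt-PneNP-2145).  The route's exact dichotomy
`NoHiddenOrder ↔ ¬ WindowBarrier` (`noHiddenOrder_iff_not_windowBarrier`) and `NoHiddenOrder_proof` (the window
canoniser) refute `WindowBarrier`: there is NO `Bud`-invariant polynomial-time language without polynomial-size
`Bud`-symmetric threshold circuits.

refuted-substantive: the load-bearing claim (a symmetry/advice lower bound for some P-language under the point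
stabiliser budget `Bud_m(⌊log₂ m⌋)`) is false — the budget leaves only `⌊log₂ m⌋` free points, and graph canonisation
of the free window by the Corneil–Goldberg recursion with certified per-path labels is symmetric of size `2^{O(log m)}`;
no cheap repair: any budget with `O(log m)` free points canonises the same way, and a larger window changes the
thesis `SymP_poly_budget` itself.
-/

namespace Summit.PneNP.PneNP.Theorems

open Summit.PneNP.PneNP.Theses.SymmetryBudget

/-- **`WindowBarrier` is false**: refuted (substantive) by `NoHiddenOrder_proof` through the dichotomy
`noHiddenOrder_iff_not_windowBarrier`.  Witness: the window canoniser `WCan.canoniser`; no cheap repair (see the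
module docstring). -/
theorem not_WindowBarrier : ¬ WindowBarrier :=
  noHiddenOrder_iff_not_windowBarrier.1 NoHiddenOrder_proof

end Summit.PneNP.PneNP.Theorems
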